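import Summits.BirchSwinnertonDyer.BirchSwinnertonDyer.Theorems.ByReductionTypeAtTwoSupersingularFlatColemanSprungBridge
import Literature.NumberTheory.EllipticCurves.Kato2004.EulerSystemBoundFineSelmerTwo
import Literature.NumberTheory.EllipticCurves.Sprung2012.LocalIwasawaModule
import Literature.NumberTheory.EllipticCurves.PAdicBSD
import HarnessLib

/-!
# Route `ByReductionTypeAtTwo` (rung K4), crux `SupersingularRankZeroAtTwo` (item stmt-BirchSwinnertonDyer-19097), line
# `odd_blind_package` v2.19, stub 3/5 `stub_flatPackage`, conjunct (8) — **FILE Z5 of hand hF3-ZETA: THE F3 CONSUMER** — from a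
# zeta generator `s₀ ∈ 𝐇¹` with the ♭ COLEMAN VALUE `Col♭(pairFun s₀) = r·L♭` (resp. `d·Col♭(pairFun s₀) = L♭`), an INTEGRALITY
# datum `t = ϖ/r ∈ ℤ₂` (resp. `t = ϖ·d ∈ ℤ₂`) and the local Euler-multiple clause for `s₀`, LITERALLY the sub-block
# F3a ∧ F3b ∧ ZL2 of conjunct (8) of `FlatCKPackageAtTwo` for ANY `P`, `loc` with `(loc x : Λ) = Col♭(pairFun x)`
# (cell `bsd-2adic`, seat `bsd-2adic-t42` GEN 51; `--supports 19097`, helper)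

HONEST FRAMING (D-0054): THEOREMS ONLY — no definition, no named fact, no instance, no `sorry`.  CONSUMER file: packaging over displayed
hypotheses; the explicit reciprocity computation that produces `r`/`d` (tower-1, hand hF3-ERL) and the integrality `t ∈ ℤ₂` ((B1)) are
NOT proved here.  Helper toward conjunct (8); closes NO stub; 19097 stays OPEN on its 5 registered stubs; nothing booked; BSD₂ is proved for
no supersingular curve and BSD for no curve by any of this; typed ≠ proved.

## What and why

Conjunct (8) (v2.19 `odd_blind_package.lean` :1608–1637) binds `∃ I Y P loc toX δ Z G, Exact loc toX ∧ Exact toX δ ∧ F3a ∧ F3b ∧ ZL2` with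
* F3a `G ∈ Submodule.map (P.subtype ∘ₗ loc) Z`,
* F3b `iwasawaToPowerSeries 2 G = PowerSeries.C (ϖ : ℚ_[2]) * iwasawaToPowerSeries 2 Lf`,
* ZL2 `∃ s₀, Z = Submodule.span Λ {s₀} ∧ ∀ 𝔭 ht 1, C 2 ∉ 𝔭 → ∃ M s, M ∉ 𝔭 ∧ IsEulerSystemClassTwo W hκ I s ∧ s ≠ 0 ∧ M • s₀ = s`.
The F1♭ hands fixed `P := ⊤`, `loc := Col♭ ∘ₗ pairFun` corestricted (`SSFlatPT.exists_exact_and_exact_of_inclusions` exports `P = ⊤ ∧ ∀ x,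
(loc x : Λ) = loc₀ x`).  Given the zeta generator `s₀` of files Z3/Z4 — `Col♭(pairFun s₀) = r·L♭` from the Coleman–Sprung bridge (p830158)
and the ZL2 clause from `exists_zetaGenerator_zetaLineLocal_two` — the three conjuncts hold with `Z := Λ∙s₀` and `G := Col♭(pairFun (C t • s₀))
= t·r·L♭ = ϖ·L♭` as soon as `t := ϖ/r` is `2`-INTEGRAL (displayed: `(t : ℚ_[2]) * r = ϖ`; tower-1's (B1) line).  No unit is needed and
`s₀` is not rescaled: every `Λ`-multiple of `s₀` lies in `Z`.
* §1 ★ `flatF3_package_of_coleman_eq` (Coleman-value form, `r : ℚ`), ★ `flatF3_package_of_mul_coleman_eq` (integral form `C d·Col♭ = L♭`,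
  `t = ϖ·d`); §2 ★★ `flatF3_package_of_congr_mazurTate` (hPS form: the layer reciprocity law `P_{n,c_n}(pairFun s₀) ≡ r·θ_n (mod ω_n)` for
  every `n`, through the bridge p830158 `iwasawaToPowerSeries_coleman_eq_C_mul_of_congr_mazurTate`).
All three are stated over the v2.19 binder types (`I : Kato2004.IwasawaH1Data W 2 κ γ`, `P : Submodule Λ Λ`, `loc : I.H →ₗ[Λ] P`,
`Lf`, `ϖ : ℚ`, the Honda-system binders `g c` of the Coleman map) so that the LEAD's fold is `obtain` + `exact`.

References: [Kato2004Asterisque] K. Kato, Astérisque 295 (2004), Thm. 12.5 (1)(4), Thm. 12.6 (pp. 221–222), §13.9, §13.12–13.14 (pp. 230–234),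
Thm. 16.6; [Sprung2012] Def. 5.9, Def. 7.1, Thm. 7.14, 7.16; [Sprung2017] Thm. 1.12, Cor. 4.4–4.5; [Kobayashi2003] Thm. 6.3.
-/

set_option autoImplicit false
-- the Theorems namespace of this sub repeats the summit name by design (D-0017 nested layout)
set_option linter.dupNamespace false

noncomputable section

open scoped Classical NumberField

open Polynomial

namespace Summit.BirchSwinnertonDyer.BirchSwinnertonDyer.Theorems

namespace SSFlatPackage

open NumberField IsDedekindDomain WeierstrassCurve Literature.NumberTheory.EllipticCurves
  Literature.NumberTheory.EllipticCurves.ZpExtension Literature.NumberTheory.EllipticCurves.Sprung2017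
  Literature.NumberTheory.EllipticCurves.Kobayashi2003 Literature.NumberTheory.EllipticCurves.Sprung2012
  Literature.NumberTheory.GaloisRepresentations CongruenceSubgroup

variable (W : WeierstrassCurve ℚ) [W.IsElliptic] [ContinuousSMul ℤ_[2] (W.tateModule 2)]
  [Module.Free ℤ_[2] (W.tateModule 2)] [Module.Finite ℤ_[2] (W.tateModule 2)]
  {κ : ZpExtension ℚ 2} (hκ : κ.IsCyclotomic) {γ : Field.absoluteGaloisGroup ℚ} (v : HeightOneSpectrum (𝓞 ℚ))
  {g : Field.absoluteGaloisGroup (v.adicCompletion ℚ)}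

/-! ## §1 The F3 package from the ♭ Coleman value of the zeta generator -/

/-- **Multipliers stay outside `𝔭` when scaled by a unit of `Λ`.** [folklore] -/
theorem mul_not_mem_of_isUnit {𝔭 : PrimeSpectrum (IwasawaAlgebra 2)} {M u : IwasawaAlgebra 2} (hM : M ∉ 𝔭.asIdeal)
    (hu : IsUnit u) : u * M ∉ 𝔭.asIdeal := fun h ↦
  ((𝔭.isPrime.mem_or_mem h).resolve_left fun hu' ↦ 𝔭.isPrime.ne_top (Ideal.eq_top_of_isUnit_mem _ hu' hu)) |> hM

/-- ★ **THE F3 PACKAGE FROM THE ♭ COLEMAN VALUE (rational form).**  Binders as in conjunct (8): the pin `I`, the Honda-system data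
`(g, c)` through a `Λ`-linear `J` carrying the Coleman values (`OddBlindNF.exists_linearMap_isColemanPair_of_traces`), a `Λ`-linear
localisation `L` (`pairFun`, p830262), ANY `P`, `loc` with `(loc x : Λ) = (J (L x)).2` (the F1♭ witness: `P = ⊤`, `loc = Col♭ ∘ₗ pairFun`),
`Lf`, `ϖ`.  INPUTS (displayed): a class `s₀ ∈ 𝐇¹` with `ι(Col♭(L s₀)) = C r·ι L♭` (the bridge p830158 applied to the layer reciprocity law —
§2), `t ∈ ℤ₂` with `t·r = ϖ` (integrality of `ϖ/r`, (B1)), and the ZL2 local clause FOR `s₀` (file Z3 `exists_zetaGenerator_zetaLineLocal_two`).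
OUTPUT: LITERALLY `∃ Z G, F3a ∧ F3b ∧ ZL2` of conjunct (8), with `Z := Λ∙s₀`, `G := (loc (C t • s₀) : Λ) = t·Col♭(L s₀)`.
[cite: Kato2004Asterisque, Thm. 12.5 (4), §13.9 (p. 230), §13.12 (pp. 231–233)] [cite: Sprung2012, Def. 7.1 (p. 1500), Thm. 7.14, 7.16] -/
theorem flatF3_package_of_coleman_eq
    (hg : κ.IsTopGenerator (resGalOfEmb (closureEmb (K := ℚ) (v.adicCompletion ℚ)) g))
    (I : Kato2004.IwasawaH1Data W 2 κ γ)
    (L : letI := moduleOfGenerator κ (closureEmb (K := ℚ) (v.adicCompletion ℚ)) W hg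
      I.H →ₗ[IwasawaAlgebra 2] (localTowerPointsOfEmb κ (closureEmb (K := ℚ) (v.adicCompletion ℚ)) W →+ ℤ_[2]))
    (J : letI := moduleOfGenerator κ (closureEmb (K := ℚ) (v.adicCompletion ℚ)) W hg
      (localTowerPointsOfEmb κ (closureEmb (K := ℚ) (v.adicCompletion ℚ)) W →+ ℤ_[2]) →ₗ[IwasawaAlgebra 2]
        IwasawaAlgebra 2 × IwasawaAlgebra 2)
    (P : Submodule (IwasawaAlgebra 2) (IwasawaAlgebra 2)) (loc : I.H →ₗ[IwasawaAlgebra 2] P)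
    (hloc : ∀ x : I.H, (loc x : IwasawaAlgebra 2) = (J (L x)).2)
    (Lf : IwasawaAlgebra 2) (ϖ : ℚ) (s₀ : I.H) (r : ℚ)
    (hCol : iwasawaToPowerSeries 2 (J (L s₀)).2 = PowerSeries.C (r : ℚ_[2]) * iwasawaToPowerSeries 2 Lf)
    (t : ℤ_[2]) (ht : (t : ℚ_[2]) * (r : ℚ_[2]) = (ϖ : ℚ_[2]))
    (hZL : ∀ 𝔭 : PrimeSpectrum (IwasawaAlgebra 2), 𝔭.asIdeal.height = 1 →
      PowerSeries.C (2 : ℤ_[2]) ∉ 𝔭.asIdeal →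
      ∃ (M : IwasawaAlgebra 2) (s : I.H), M ∉ 𝔭.asIdeal ∧
        Literature.NumberTheory.EllipticCurves.Kato2004.IsEulerSystemClassTwo W hκ I s ∧ s ≠ 0 ∧ M • s₀ = s) :
    ∃ (Z : Submodule (IwasawaAlgebra 2) I.H) (G : IwasawaAlgebra 2),
      G ∈ Submodule.map (P.subtype ∘ₗ loc) Z ∧
      iwasawaToPowerSeries 2 G = PowerSeries.C (ϖ : ℚ_[2]) * iwasawaToPowerSeries 2 Lf ∧
      (∃ s₀ : I.H, Z = Submodule.span (IwasawaAlgebra 2) {s₀} ∧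
        ∀ 𝔭 : PrimeSpectrum (IwasawaAlgebra 2), 𝔭.asIdeal.height = 1 →
          PowerSeries.C (2 : ℤ_[2]) ∉ 𝔭.asIdeal →
          ∃ (M : IwasawaAlgebra 2) (s : I.H), M ∉ 𝔭.asIdeal ∧
            Literature.NumberTheory.EllipticCurves.Kato2004.IsEulerSystemClassTwo W hκ I s ∧ s ≠ 0 ∧
            M • s₀ = s) := by
  letI := moduleOfGenerator κ (closureEmb (K := ℚ) (v.adicCompletion ℚ)) W hg
  refine ⟨Submodule.span (IwasawaAlgebra 2) {s₀}, (loc ((PowerSeries.C t : IwasawaAlgebra 2) • s₀) : IwasawaAlgebra 2),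
    ⟨(PowerSeries.C t : IwasawaAlgebra 2) • s₀, Submodule.smul_mem _ _ (Submodule.mem_span_singleton_self s₀), rfl⟩, ?_,
    s₀, rfl, hZL⟩
  -- F3b: `ι(t·Col♭(L s₀)) = C t · C r · ι L♭ = C ϖ · ι L♭`
  rw [hloc, map_smul, map_smul, Prod.smul_snd, smul_eq_mul, map_mul, hCol, ← mul_assoc]
  congr 1
  rw [PowerSeries.map_C, ← map_mul]
  exact congrArg _ ht

/-- ★ **THE F3 PACKAGE FROM THE ♭ COLEMAN VALUE (integral form).**  The same with the Coleman identity in the shape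
`C d · Col♭(L s₀) = L♭` in `Λ` (`d ∈ ℤ₂`: the common denominator of the layer reciprocity law, i.e. `Col♭(L (C d • s₀)) = L♭`) and the
integrality datum `t = ϖ·d ∈ ℤ₂`; `G := Col♭(L (C t • s₀))`. [cite: Kato2004Asterisque, Thm. 12.5 (4), §13.12 (pp. 231–233)]
[cite: Sprung2012, Def. 7.1 (p. 1500), Thm. 7.14, 7.16] -/
theorem flatF3_package_of_mul_coleman_eq
    (hg : κ.IsTopGenerator (resGalOfEmb (closureEmb (K := ℚ) (v.adicCompletion ℚ)) g))
    (I : Kato2004.IwasawaH1Data W 2 κ γ)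
    (L : letI := moduleOfGenerator κ (closureEmb (K := ℚ) (v.adicCompletion ℚ)) W hg
      I.H →ₗ[IwasawaAlgebra 2] (localTowerPointsOfEmb κ (closureEmb (K := ℚ) (v.adicCompletion ℚ)) W →+ ℤ_[2]))
    (J : letI := moduleOfGenerator κ (closureEmb (K := ℚ) (v.adicCompletion ℚ)) W hg
      (localTowerPointsOfEmb κ (closureEmb (K := ℚ) (v.adicCompletion ℚ)) W →+ ℤ_[2]) →ₗ[IwasawaAlgebra 2]
        IwasawaAlgebra 2 × IwasawaAlgebra 2)
    (P : Submodule (IwasawaAlgebra 2) (IwasawaAlgebra 2)) (loc : I.H →ₗ[IwasawaAlgebra 2] P)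
    (hloc : ∀ x : I.H, (loc x : IwasawaAlgebra 2) = (J (L x)).2)
    (Lf : IwasawaAlgebra 2) (ϖ : ℚ) (s₀ : I.H) (d : ℤ_[2])
    (hCol : (PowerSeries.C d : IwasawaAlgebra 2) * (J (L s₀)).2 = Lf)
    (t : ℤ_[2]) (ht : (t : ℚ_[2]) = (ϖ : ℚ_[2]) * (d : ℚ_[2]))
    (hZL : ∀ 𝔭 : PrimeSpectrum (IwasawaAlgebra 2), 𝔭.asIdeal.height = 1 →
      PowerSeries.C (2 : ℤ_[2]) ∉ 𝔭.asIdeal →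
      ∃ (M : IwasawaAlgebra 2) (s : I.H), M ∉ 𝔭.asIdeal ∧
        Literature.NumberTheory.EllipticCurves.Kato2004.IsEulerSystemClassTwo W hκ I s ∧ s ≠ 0 ∧ M • s₀ = s) :
    ∃ (Z : Submodule (IwasawaAlgebra 2) I.H) (G : IwasawaAlgebra 2),
      G ∈ Submodule.map (P.subtype ∘ₗ loc) Z ∧
      iwasawaToPowerSeries 2 G = PowerSeries.C (ϖ : ℚ_[2]) * iwasawaToPowerSeries 2 Lf ∧
      (∃ s₀ : I.H, Z = Submodule.span (IwasawaAlgebra 2) {s₀} ∧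
        ∀ 𝔭 : PrimeSpectrum (IwasawaAlgebra 2), 𝔭.asIdeal.height = 1 →
          PowerSeries.C (2 : ℤ_[2]) ∉ 𝔭.asIdeal →
          ∃ (M : IwasawaAlgebra 2) (s : I.H), M ∉ 𝔭.asIdeal ∧
            Literature.NumberTheory.EllipticCurves.Kato2004.IsEulerSystemClassTwo W hκ I s ∧ s ≠ 0 ∧
            M • s₀ = s) := by
  letI := moduleOfGenerator κ (closureEmb (K := ℚ) (v.adicCompletion ℚ)) W hg
  refine ⟨Submodule.span (IwasawaAlgebra 2) {s₀}, (loc ((PowerSeries.C t : IwasawaAlgebra 2) • s₀) : IwasawaAlgebra 2),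
    ⟨(PowerSeries.C t : IwasawaAlgebra 2) • s₀, Submodule.smul_mem _ _ (Submodule.mem_span_singleton_self s₀), rfl⟩, ?_,
    s₀, rfl, hZL⟩
  -- F3b: `ι(t·Col♭(L s₀)) = C ϖ · ι(C d·Col♭(L s₀)) = C ϖ · ι L♭`
  rw [hloc, map_smul, map_smul, Prod.smul_snd, smul_eq_mul, ← hCol, map_mul, map_mul, ← mul_assoc, PowerSeries.map_C,
    PowerSeries.map_C, ← map_mul]
  exact congrArg (fun a : ℚ_[2] ↦ PowerSeries.C a * iwasawaToPowerSeries 2 (J (L s₀)).2) ht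

/-! ## §2 The F3 package from the layer reciprocity law (hPS form), through the Coleman–Sprung bridge -/

/-- ★★ **THE F3 PACKAGE FROM THE LAYER RECIPROCITY LAW.**  If the zeta generator `s₀ ∈ 𝐇¹` satisfies, at every layer `n`,
`P_{n,c_n}(L s₀) ≡ r·θ_n (mod ω_n)` in `Λ ⊗ ℚ₂` (`IsCongrModOmega 2 n (C r · mazurTateElement f 2 n) 1 (pairingSum … (L s₀))` — the output of
the division step, file Z4, from tower-1's levelwise congruences for Kato's lifts), `(Ls, Lf)` is the Sprung pair of `f` at `2` and `2 ∣ a₂`,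
then with `t·r = ϖ`, `t ∈ ℤ₂`, and the ZL2 clause for `s₀`: LITERALLY `∃ Z G, F3a ∧ F3b ∧ ZL2` of conjunct (8) — the bridge p830158 turns the
layer law into `ι(Col♭(L s₀)) = C r·ι L♭` on the nose (uniqueness of chromatic limits). [cite: Kato2004Asterisque, Thm. 12.5 (1) (pp. 221–222),
Thm. 16.6, §13.12 (pp. 231–233)] [cite: Sprung2017, Thm. 1.12, Cor. 4.4–4.5] [cite: Sprung2012, Prop. 5.7, Def. 5.9 (p. 1495), Def. 7.1 (p. 1500)] -/
theorem flatF3_package_of_congr_mazurTate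
    (hg : κ.IsTopGenerator (resGalOfEmb (closureEmb (K := ℚ) (v.adicCompletion ℚ)) g))
    {ap : ℤ} (hap : (2 : ℤ) ∣ ap) {c : ℕ → localPoints W (v.adicCompletion ℚ)}
    (I : Kato2004.IwasawaH1Data W 2 κ γ)
    (L : letI := moduleOfGenerator κ (closureEmb (K := ℚ) (v.adicCompletion ℚ)) W hg
      I.H →ₗ[IwasawaAlgebra 2] (localTowerPointsOfEmb κ (closureEmb (K := ℚ) (v.adicCompletion ℚ)) W →+ ℤ_[2]))
    (J : letI := moduleOfGenerator κ (closureEmb (K := ℚ) (v.adicCompletion ℚ)) W hg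
      (localTowerPointsOfEmb κ (closureEmb (K := ℚ) (v.adicCompletion ℚ)) W →+ ℤ_[2]) →ₗ[IwasawaAlgebra 2]
        IwasawaAlgebra 2 × IwasawaAlgebra 2)
    (hJ : ∀ w, IsColemanPair κ (closureEmb (K := ℚ) (v.adicCompletion ℚ)) W ap g c w (J w).1 (J w).2)
    (P : Submodule (IwasawaAlgebra 2) (IwasawaAlgebra 2)) (loc : I.H →ₗ[IwasawaAlgebra 2] P)
    (hloc : ∀ x : I.H, (loc x : IwasawaAlgebra 2) = (J (L x)).2)
    {N : ℕ} (f : CuspForm (Gamma0 N) 2) (ϖ : ℚ) (Ls Lf : IwasawaAlgebra 2) (hL : IsSprungPair f 2 ap Ls Lf)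
    (s₀ : I.H) (r : ℚ)
    (hPS : ∀ n : ℕ, IsCongrModOmega 2 n (Polynomial.C r * mazurTateElement f 2 n) 1
      (pairingSum W (localTowerPointsOfEmb κ (closureEmb (K := ℚ) (v.adicCompletion ℚ)) W) g n (c n) (L s₀)))
    (t : ℤ_[2]) (ht : (t : ℚ_[2]) * (r : ℚ_[2]) = (ϖ : ℚ_[2]))
    (hZL : ∀ 𝔭 : PrimeSpectrum (IwasawaAlgebra 2), 𝔭.asIdeal.height = 1 →
      PowerSeries.C (2 : ℤ_[2]) ∉ 𝔭.asIdeal →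
      ∃ (M : IwasawaAlgebra 2) (s : I.H), M ∉ 𝔭.asIdeal ∧
        Literature.NumberTheory.EllipticCurves.Kato2004.IsEulerSystemClassTwo W hκ I s ∧ s ≠ 0 ∧ M • s₀ = s) :
    ∃ (Z : Submodule (IwasawaAlgebra 2) I.H) (G : IwasawaAlgebra 2),
      G ∈ Submodule.map (P.subtype ∘ₗ loc) Z ∧
      iwasawaToPowerSeries 2 G = PowerSeries.C (ϖ : ℚ_[2]) * iwasawaToPowerSeries 2 Lf ∧
      (∃ s₀ : I.H, Z = Submodule.span (IwasawaAlgebra 2) {s₀} ∧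
        ∀ 𝔭 : PrimeSpectrum (IwasawaAlgebra 2), 𝔭.asIdeal.height = 1 →
          PowerSeries.C (2 : ℤ_[2]) ∉ 𝔭.asIdeal →
          ∃ (M : IwasawaAlgebra 2) (s : I.H), M ∉ 𝔭.asIdeal ∧
            Literature.NumberTheory.EllipticCurves.Kato2004.IsEulerSystemClassTwo W hκ I s ∧ s ≠ 0 ∧
            M • s₀ = s) := by
  obtain ⟨-, hflat⟩ := iwasawaToPowerSeries_coleman_eq_C_mul_of_congr_mazurTate κ (closureEmb (K := ℚ) (v.adicCompletion ℚ)) W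
    hap (hJ (L s₀)) f hL r hPS
  exact flatF3_package_of_coleman_eq W hκ v hg I L J P loc hloc Lf ϖ s₀ r hflat t ht hZL

end SSFlatPackage

end Summit.BirchSwinnertonDyer.BirchSwinnertonDyer.Theorems

end
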